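import Summits.RiemannHypothesis.RiemannHypothesis.Theorems.WeilColumnThetaUCCheb
import Summits.RiemannHypothesis.RiemannHypothesis.Theorems.WeilColumnThetaPrimeSideT2
import Summits.RiemannHypothesis.RiemannHypothesis.Theorems.WeilColumnThetaCrossTermT2
import Summits.RiemannHypothesis.RiemannHypothesis.Theorems.WeilColumnThetaCellNormsT2
import HarnessLib

/-!
# Tier-2 PR Step 5′: `Re Q(T_R⁻ ⋆ moll_k) ≤ primesC + cross₂ + arch(Ā, B′) + e` eventually in `k` — by CONVERGENCE of the prime term (RH-FREE)

WEIL column (LADDER-RH, W-P(P2); route `WeilSemilocal`, tier-2 twin residue, item 19172; cc-s2-1 gen22 TIER2-KERNEL-SPEC §3/§5, THETA-CERT-cc6 §E).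
Tier 1 (`re_weilQuadratic_moll_oddTail_le_of_ge`) bounded the prime side of the MOLLIFIED tail at level `k` with inflated exponential
envelopes; the tier-2 cell envelopes do not survive mollification, so here the prime term is bounded IN THE LIMIT:

* §1 (abstract, namespace `ThetaPrime`) the autocorrelation `g ⋆ g̃` of ANY `g` vanishing off `[−a, a]` vanishes off `[−2a, 2a]`; hence D6′
  (`norm_weilPrimeTerm_le_of_oddTail_cell`) WITHOUT the smoothness hypothesis; and `k ↦ ‖primes((f⋆moll_k) ⋆ (f⋆moll_k)~)‖ → ‖primes(f ⋆ f̃)‖`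
  for continuous compactly supported `f` (dominated convergence, finite prime sum);
* §2 (witness) **`norm_weilPrimeTerm_TROdd_le_T2`**: `‖primes(T_R⁻ ⋆ T̃_R⁻)‖ ≤ primesC + 2·C·M₀²·[Gs 0 + Σ_{k<Kw}Gs_k(e^{(k+1)τ} − e^{kτ}) + ζ(m+1)²e^{−mW_l}(W_l/m + 1/m²)]`
  for EVERY `R`, under `ψ ≤ C·x` on `[e^{−2x₁}, ∞)` and the (K4)-shaped cell hypotheses (E2's `tailEnv ≤ envX_i` on the cells, `H_k`, hull `Gs`);
* §3 **`eventually_re_weilQuadratic_TRk_le_T2`**: for `R ≥ 0`, `Ā ≥ ∫‖T_R⁻‖²`, `B′ ≥ ∫‖(T_R⁻)′‖²`, `0 < t₀ ≤ 1`, every `e > 0`, eventually in `k`: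
  `Re Q(T_R⁻ ⋆ moll_k) ≤ primesC + cross₂ + (B′/2·e^{t₀/2}t₀²/2 + Ā·(2·Jexplicit t₀ − log 4π − γ − C₁)₊) + e` (polar ≤ 0, D7, §1–§2).
Nothing here bears on the truth of RH.
-/

noncomputable section

set_option linter.dupNamespace false

open Complex Set MeasureTheory Filter Finset
open scoped Real Topology ComplexConjugate ArithmeticFunction.vonMangoldt Chebyshev

namespace Summit.RiemannHypothesis.RiemannHypothesis.Theorems.WeilColumn

open Literature.NumberTheory.LFunctions Literature.NumberTheory.LFunctions.WeilContinuous

namespace ThetaPrime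

/-! ## §1 The prime side without smoothness, and its continuity along the mollification -/

/-- The autocorrelation of a function vanishing off `[−a, a]` vanishes off `[−2a, 2a]` (pointwise: one factor of the integrand is zero). [folklore] -/
theorem weilConv_weilReflect_eq_zero_of_lt_abs {g : ℝ → ℂ} {a : ℝ} (hg0 : ∀ u, a < |u| → g u = 0) {t : ℝ} (ht : 2 * a < |t|) :
    weilConv g (weilReflect g) t = 0 := by
  rw [weilConv_apply]
  refine integral_eq_zero_of_ae (Eventually.of_forall fun x ↦ ?_)
  simp only [Pi.zero_apply, weilReflect]
  by_cases hx : a < |x|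
  · rw [hg0 x hx, zero_mul]
  · have h2 : a < |-(t - x)| := by
      rw [abs_neg]
      have h3 := abs_add_le x (t - x)
      rw [add_sub_cancel] at h3
      linarith [not_lt.1 hx]
    rw [hg0 _ h2, map_zero, mul_zero]

variable {T g : ℝ → ℂ} {E Ec x₁ : ℝ} {e Ve : ℝ → ℝ}

/-- **D6′ without smoothness**: as `norm_weilPrimeTerm_le_of_oddTail_cell`, with `IsWeilTest g` + `tsupport g ⊆ [−a,a]` replaced by
the bare vanishing `g u = 0` for `|u| > a`. [THETA-CERT-cc6 §D6/§E4; TIER2-KERNEL-SPEC §2/§5] -/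
theorem norm_weilPrimeTerm_le_of_oddTail_cell' {m : ℕ} (hx₁ : x₁ < 0) (hE : 0 ≤ E) (hEc : 0 ≤ Ec)
    (hT0 : ∀ u, x₁ < u → T u = 0)
    (hTE : ∀ u, u ≤ x₁ → ‖T u‖ ≤ E * Real.exp (((m : ℝ) + 1 / 2) * (u - x₁)))
    (hec : Continuous e) (he0 : ∀ s, 0 ≤ e s) (hTe : ∀ s, 0 ≤ s → ‖T (x₁ - s)‖ ≤ Ec * e s)
    (hVe0 : ∀ w, 0 ≤ Ve w) (hVe : ∀ w, 0 ≤ w → ∫ s in (0 : ℝ)..w, e s * e (w - s) ≤ Ve w)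
    {a : ℝ} (hga : ∀ u, a < |u| → g u = 0) (hg : ∀ u, g u = T u - T (-u))
    {S₁ X : ℝ}
    (hS₁ : ∀ K : ℕ, ∑ n ∈ Finset.range K, (Λ n : ℝ) / (n : ℝ) ^ (m + 1) ≤ S₁)
    (hX : ∀ K : ℕ, ∑ n ∈ Finset.range K, (Λ n : ℝ) / Real.sqrt n * Ve (Real.log n + 2 * x₁) ≤ X) :
    ‖weilPrimeTerm (weilConv g (weilReflect g))‖ ≤ 2 * E ^ 2 / ((m : ℝ) + 1 / 2) * S₁ + 2 * Ec ^ 2 * X := by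
  set k : ℝ → ℂ := weilConv g (weilReflect g) with hk
  set κ : ℝ := (m : ℝ) + 1 / 2 with hκ
  have hκ0 : 0 < κ := by rw [hκ]; positivity
  have hkz : ∀ u : ℝ, 2 * a < |u| → k u = 0 := fun u hu ↦ weilConv_weilReflect_eq_zero_of_lt_abs hga hu
  rw [WeilContinuous.weilPrimeTerm_eq_sum_of_support hkz]
  set K : ℕ := ⌈Real.exp (2 * a + 1)⌉₊ with hK
  have hterm : ∀ n ∈ Finset.range K,
      ‖((Λ n : ℝ) : ℂ) / (Real.sqrt n : ℂ) * (k (Real.log n) + k (-Real.log n))‖ ≤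
        2 * E ^ 2 / κ * ((Λ n : ℝ) / (n : ℝ) ^ (m + 1)) + 2 * Ec ^ 2 * ((Λ n : ℝ) / Real.sqrt n * Ve (Real.log n + 2 * x₁)) := by
    intro n _
    rcases Nat.eq_zero_or_pos n with h0 | hn
    · subst h0; simp
    have hn1 : 1 ≤ n := hn
    have hΛ : 0 ≤ (Λ n : ℝ) := ArithmeticFunction.vonMangoldt_nonneg
    have hlog : 0 ≤ Real.log n := Real.log_natCast_nonneg n
    have hkb := norm_weilConv_weilReflect_oddTail_le_cell hx₁ hκ0 hE hEc hT0 (by simpa [hκ] using hTE) hec he0 hTe hVe0 hVe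
      hg hlog
    have h2 := norm_weilConv_weilReflect_add_neg_le g (Real.log n)
    have hw := (weights_at_log (m := m) hn1 x₁).1
    rw [norm_mul, norm_div, Complex.norm_real, Complex.norm_real, Real.norm_of_nonneg hΛ,
      Real.norm_of_nonneg (Real.sqrt_nonneg _)]
    have hsq0 : 0 < Real.sqrt n := Real.sqrt_pos.2 (by exact_mod_cast hn)
    calc (Λ n : ℝ) / Real.sqrt n * ‖k (Real.log n) + k (-Real.log n)‖
        ≤ (Λ n : ℝ) / Real.sqrt n * (2 * (E ^ 2 * Real.exp (-κ * Real.log n) / κ + Ec ^ 2 * Ve (Real.log n + 2 * x₁))) :=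
          mul_le_mul_of_nonneg_left (h2.trans (by linarith [hkb])) (div_nonneg hΛ hsq0.le)
      _ = 2 * E ^ 2 / κ * ((Λ n : ℝ) * ((1 / Real.sqrt n) * Real.exp (-κ * Real.log n))) +
            2 * Ec ^ 2 * ((Λ n : ℝ) / Real.sqrt n * Ve (Real.log n + 2 * x₁)) := by
          field_simp
      _ = _ := by rw [hκ, hw]; ring
  refine (norm_sum_le _ _).trans ((Finset.sum_le_sum hterm).trans ?_)
  rw [Finset.sum_add_distrib, ← Finset.mul_sum, ← Finset.mul_sum]
  have hE2 : 0 ≤ 2 * E ^ 2 / κ := by positivity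
  have hE3 : 0 ≤ 2 * Ec ^ 2 := by positivity
  exact add_le_add (mul_le_mul_of_nonneg_left (hS₁ K) hE2) (mul_le_mul_of_nonneg_left (hX K) hE3)

/-- **The autocorrelation kernel along the mollification converges pointwise**: for `f` continuous with `f u = 0` for `|u| > a`,
`((f⋆moll_k) ⋆ (f⋆moll_k)~)(t) → (f ⋆ f̃)(t)`. [folklore; dominated convergence] -/
theorem tendsto_weilConv_weilReflect_moll {f : ℝ → ℂ} {a : ℝ} (hfc : Continuous f) (hfs : HasCompactSupport f)
    (hf0 : ∀ u, a < |u| → f u = 0) (t : ℝ) :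
    Tendsto (fun k ↦ weilConv (weilConv f (moll k)) (weilReflect (weilConv f (moll k))) t) atTop
      (𝓝 (weilConv f (weilReflect f) t)) := by
  obtain ⟨S, hS⟩ := hfc.bounded_above_of_compact_support hfs
  have hS0 : 0 ≤ S := (norm_nonneg _).trans (hS 0)
  set φ : ℕ → ℝ → ℂ := fun k ↦ weilConv f (moll k) with hφ
  have hφb : ∀ k u, ‖φ k u‖ ≤ S := fun k u ↦ ThetaMellin.norm_weilConv_moll_le_of_local_bound k fun v _ ↦ hS v
  have hφ0 : ∀ k u, a + 1 < |u| → φ k u = 0 := fun k u hu ↦ weilConv_moll_eq_zero hf0 hu k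
  have hφc : ∀ k, Continuous (φ k) := fun k ↦ (isWeilTest_weilConv_moll hfc hfs k).1.continuous
  have hφlim : ∀ u, Tendsto (fun k ↦ φ k u) atTop (𝓝 (f u)) := fun u ↦ WeilContinuous.tendsto_weilConv_moll hfc u
  show Tendsto (fun k ↦ weilConv (φ k) (weilReflect (φ k)) t) atTop (𝓝 (weilConv f (weilReflect f) t))
  simp only [weilConv_apply]
  refine tendsto_integral_of_dominated_convergence ((Icc (-(a + 1)) (a + 1)).indicator fun _ ↦ S * S) ?_ ?_ ?_ ?_
  · intro k
    exact ((hφc k).mul (Complex.continuous_conj.comp ((hφc k).comp (continuous_const.sub continuous_id).neg))).aestronglyMeasurable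
  · exact (continuous_const.integrableOn_Icc (a := -(a + 1)) (b := a + 1)).integrable_indicator measurableSet_Icc
  · intro k
    refine Eventually.of_forall fun u ↦ ?_
    by_cases hu : u ∈ Icc (-(a + 1)) (a + 1)
    · rw [indicator_of_mem hu, weilReflect, norm_mul, Complex.norm_conj]
      exact mul_le_mul (hφb k u) (hφb k _) (norm_nonneg _) hS0
    · rw [indicator_of_notMem hu]
      have : a + 1 < |u| := by
        rw [Set.mem_Icc, not_and_or, not_le, not_le] at hu
        rcases hu with hu | hu
        · exact lt_of_lt_of_le (by linarith) (neg_le_abs u)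
        · exact lt_of_lt_of_le hu (le_abs_self u)
      rw [hφ0 k u this, zero_mul, norm_zero]
  · refine Eventually.of_forall fun u ↦ ?_
    have h1 := hφlim u
    have h2 : Tendsto (fun k ↦ weilReflect (φ k) (t - u)) atTop (𝓝 (weilReflect f (t - u))) := by
      simp only [weilReflect]
      exact (Complex.continuous_conj.tendsto _).comp (hφlim (-(t - u)))
    exact h1.mul h2

/-- **The prime term along the mollification converges**: `‖primes((f⋆moll_k) ⋆ (f⋆moll_k)~)‖ → ‖primes(f ⋆ f̃)‖`
(finite prime sums over a common range). [folklore] -/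
theorem tendsto_norm_weilPrimeTerm_moll {f : ℝ → ℂ} {a : ℝ} (hfc : Continuous f) (hfs : HasCompactSupport f)
    (hf0 : ∀ u, a < |u| → f u = 0) :
    Tendsto (fun k ↦ ‖weilPrimeTerm (weilConv (weilConv f (moll k)) (weilReflect (weilConv f (moll k))))‖) atTop
      (𝓝 ‖weilPrimeTerm (weilConv f (weilReflect f))‖) := by
  have hφ0 : ∀ k u, a + 1 < |u| → weilConv f (moll k) u = 0 := fun k u hu ↦ weilConv_moll_eq_zero hf0 hu k
  have hkz : ∀ k, ∀ u : ℝ, 2 * (a + 1) < |u| → weilConv (weilConv f (moll k)) (weilReflect (weilConv f (moll k))) u = 0 :=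
    fun k u hu ↦ weilConv_weilReflect_eq_zero_of_lt_abs (hφ0 k) hu
  have hfz : ∀ u : ℝ, 2 * (a + 1) < |u| → weilConv f (weilReflect f) u = 0 := fun u hu ↦
    weilConv_weilReflect_eq_zero_of_lt_abs hf0 (by linarith [abs_nonneg u])
  refine (continuous_norm.tendsto _).comp ?_
  rw [WeilContinuous.weilPrimeTerm_eq_sum_of_support hfz]
  simp_rw [WeilContinuous.weilPrimeTerm_eq_sum_of_support (hkz _)]
  refine tendsto_finsetSum _ fun n _ ↦ ?_
  exact tendsto_const_nhds.mul ((tendsto_weilConv_weilReflect_moll hfc hfs hf0 _).add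
    (tendsto_weilConv_weilReflect_moll hfc hfs hf0 _))

end ThetaPrime

namespace ThetaMellin

open ThetaParams ThetaPrime

namespace ThetaParams

variable {P : ThetaParams}

/-! ## §2 The tier-2 prime side of `T_R⁻ ⋆ T̃_R⁻`, uniformly in `R` -/

/-- `√(e^{−2x₁}) = u₁⁻¹`. [folklore] -/
theorem sqrt_exp_neg_two_x₁ (P : ThetaParams) : Real.sqrt (Real.exp (-2 * P.x₁)) = P.u₁⁻¹ := by
  have e : Real.exp (-2 * P.x₁) = Real.exp (-P.x₁) ^ 2 := by rw [← Real.exp_nat_mul]; ring_nf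
  rw [e, Real.sqrt_sq (Real.exp_pos _).le, Real.exp_neg]
  rfl

/-- **D6₂ at the witness — the tier-2 PRIME SIDE for every truncation `R`**: under `ψ ≤ C·x` on `[e^{−2x₁}, ∞)` and the (K4)-shaped cell data
(`tailEnv ≤ envX_i` on every closed depth cell, `H_k ≥ τΣ_{i≤k}envX_i·max(envX_{k−i−1}, envX_{k−i})`, `Gs_k ≥ H_k e^{−kτ/2}`, `Gs ≥ 0`
non-increasing up to `Kw`, glue `ζ(m+1)²W_l e^{−(m+1)W_l} ≤ Gs_{Kw}`, `W_l = Kwτ ≥ 1/(m+1)`):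
`‖primes(T_R⁻ ⋆ T̃_R⁻)‖ ≤ primesC + 2·C·M₀²·[Gs 0 + Σ_{k<Kw}Gs_k(e^{(k+1)τ} − e^{kτ}) + ζ(m+1)²e^{−mW_l}(W_l/m + 1/m²)]`.
[THETA-CERT-cc6 §E4/§E5; TIER2-KERNEL-SPEC §2/§5 (K3)/(K4)] -/
theorem norm_weilPrimeTerm_TROdd_le_T2 {qn : ℕ} (hP : P.Admissible qn) {C : ℝ} (hC : 0 ≤ C)
    (hψ : ∀ x : ℝ, Real.exp (-2 * P.x₁) ≤ x → ψ x ≤ C * x)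
    {τ Wl : ℝ} {Kw : ℕ} (hτ : 0 < τ) (hWl : Wl = Kw * τ) (hWl1 : 1 / ((P.m : ℝ) + 1) ≤ Wl)
    {envX H Gs : ℕ → ℝ} (henv0 : ∀ i, 0 ≤ envX i)
    (henv : ∀ (i : ℕ) (t : ℝ), (i : ℝ) * τ ≤ t → t ≤ ((i : ℝ) + 1) * τ → P.tailEnv t ≤ envX i)
    (hH : ∀ k < Kw, τ * ∑ i ∈ Finset.range (k + 1), envX i * max (envX (k - i - 1)) (envX (k - i)) ≤ H k)
    (hGs : ∀ k < Kw, H k * Real.exp (-(k * τ) / 2) ≤ Gs k)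
    (hGs0 : ∀ k, 0 ≤ Gs k) (hanti : ∀ k, k + 1 ≤ Kw → Gs (k + 1) ≤ Gs k)
    (hglue : zetaTail (P.m + 1) ^ 2 * Wl * Real.exp (-((P.m : ℝ) + 1) * Wl) ≤ Gs Kw) (R : ℝ) :
    ‖weilPrimeTerm (weilConv (P.TROdd R) (weilReflect (P.TROdd R)))‖ ≤
      P.primesC + 2 * C * P.M₀ ^ 2 * (Gs 0 + ∑ k ∈ Finset.range Kw, Gs k * (Real.exp ((k + 1) * τ) - Real.exp (k * τ)) +
        zetaTail (P.m + 1) ^ 2 * Real.exp (-(P.m : ℝ) * Wl) * (Wl / P.m + 1 / (P.m : ℝ) ^ 2)) := by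
  have hx₁ : P.x₁ < 0 := P.x₁_neg hP
  have hm2 : 2 ≤ P.m := le_trans (by norm_num) hP.three_le
  have hm0 : (0 : ℝ) < P.m := by exact_mod_cast (show 0 < P.m by omega)
  have hu : 0 < P.u₁ := Real.exp_pos _
  have hM₀ := P.M₀_pos hP
  obtain ⟨hM, -⟩ := M_nonneg_M₁_nonneg hP
  have hζ : 0 ≤ zetaTail (P.m + 1) := le_trans (P.tailEnv_nonneg hP 0) (by simpa using P.tailEnv_le_exp hP 0)
  set N : ℝ := Real.exp (-2 * P.x₁) with hN
  have hN1 : 1 ≤ N := by rw [hN]; exact Real.one_le_exp (by linarith)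
  have hlogN : Real.log N = -2 * P.x₁ := by rw [hN, Real.log_exp]
  -- the convolution majorant `Ve w = (∫_0^w e·e)₊`
  set Ve : ℝ → ℝ := fun w ↦ max 0 (∫ s in (0 : ℝ)..w, P.tailEnv s * P.tailEnv (w - s)) with hVe
  have hVe0 : ∀ w, 0 ≤ Ve w := fun w ↦ le_max_left _ _
  have hVe1 : ∀ w, 0 ≤ w → ∫ s in (0 : ℝ)..w, P.tailEnv s * P.tailEnv (w - s) ≤ Ve w := fun w _ ↦ le_max_right _ _
  have hVneg : ∀ w, w < 0 → Ve w ≤ 0 := by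
    intro w hw
    rw [hVe]
    refine max_le le_rfl ?_
    rw [intervalIntegral.integral_symm]
    have : 0 ≤ ∫ s in w..(0 : ℝ), P.tailEnv s * P.tailEnv (w - s) :=
      intervalIntegral.integral_nonneg hw.le fun s _ ↦ mul_nonneg (P.tailEnv_nonneg hP _) (P.tailEnv_nonneg hP _)
    linarith
  have hVe2 : ∀ w, 0 ≤ w → Ve w ≤ ∫ s in (0 : ℝ)..w, P.tailEnv s * P.tailEnv (w - s) := by
    intro w hw
    refine max_le ?_ le_rfl
    exact intervalIntegral.integral_nonneg hw fun s _ ↦ mul_nonneg (P.tailEnv_nonneg hP _) (P.tailEnv_nonneg hP _)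
  -- E4 + E5: the cross sum
  have hX := sum_vonMangoldt_cross_le (μ := (P.m : ℝ)) (Z := zetaTail (P.m + 1)) hN1 hτ hWl hm0 hWl1 hζ hC
    (P.continuous_tailEnv hP) (P.tailEnv_nonneg hP) (fun s _ ↦ P.tailEnv_le_exp hP s) henv0 henv hH hGs hGs0 hanti
    hglue hVneg hVe2 hψ
  -- D6′ at `T = T_R`, `g = T_R⁻`, `E = M√u₁`, `E_c = √u₁M₀`, `e = tailEnv`
  obtain ⟨a, -, hR1⟩ := WeilContinuous.exists_support_radius (hasCompactSupport_TROdd hP R)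
  have eV : ∀ n : ℕ, Real.log n - Real.log N = Real.log n + 2 * P.x₁ := fun n ↦ by rw [hlogN]; ring
  have hD6 := norm_weilPrimeTerm_le_of_oddTail_cell' (m := P.m) (T := P.TR R) (g := P.TROdd R) (E := P.M * Real.sqrt P.u₁)
    (Ec := Real.sqrt P.u₁ * P.M₀) (e := P.tailEnv) (Ve := Ve) hx₁ (by positivity) (by positivity)
    (fun u hu ↦ TR_eq_zero_of_gt hP R hu) (fun u _ ↦ norm_TR_le hP R u) (P.continuous_tailEnv hP) (P.tailEnv_nonneg hP)
    (fun s _ ↦ P.norm_TR_depth_le_tailEnv hP R s) hVe0 hVe1 hR1 (fun u ↦ rfl)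
    (fun K ↦ sum_vonMangoldt_div_pow_le hm2 K) (fun K ↦ by have h := hX K; simp only [eV] at h; exact h)
  -- constants: `2(M√u₁)²/(m+½)·ΣΛn^{−(m+1)} = primesC`, `2(√u₁M₀)²·C√N = 2CM₀²` (`u₁√N = 1`)
  set X : ℝ := Gs 0 + ∑ k ∈ Finset.range Kw, Gs k * (Real.exp ((k + 1) * τ) - Real.exp (k * τ)) +
    zetaTail (P.m + 1) ^ 2 * Real.exp (-(P.m : ℝ) * Wl) * (Wl / P.m + 1 / (P.m : ℝ) ^ 2) with hXdef
  have hsqN : Real.sqrt N = P.u₁⁻¹ := P.sqrt_exp_neg_two_x₁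
  have hm1 : (P.m : ℝ) + 1 / 2 ≠ 0 := by positivity
  have hm3 : (2 : ℝ) * P.m + 1 ≠ 0 := by positivity
  have hu0 : P.u₁ ≠ 0 := hu.ne'
  have e1 : 2 * (P.M * Real.sqrt P.u₁) ^ 2 / ((P.m : ℝ) + 1 / 2) * vonMangoldtSum (P.m + 1) = P.primesC := by
    rw [mul_pow, Real.sq_sqrt hu.le]
    unfold primesC
    field_simp
    ring
  have e2 : 2 * (Real.sqrt P.u₁ * P.M₀) ^ 2 * (C * Real.sqrt N * X) = 2 * C * P.M₀ ^ 2 * X := by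
    rw [mul_pow, Real.sq_sqrt hu.le, hsqN]
    field_simp
  rw [e1, e2] at hD6
  exact hD6

/-! ## §3 Tier-2 Step 5′ on `T_R⁻ ⋆ moll_k`, eventually in `k` -/

/-- **TIER-2 STEP 5′** (see the module docstring). [THETA-CERT-cc6 §E; TIER2-KERNEL-SPEC §3/§5] -/
theorem eventually_re_weilQuadratic_TRk_le_T2 {qn : ℕ} (hP : P.Admissible qn) {primeBound : ℝ}
    (hprimes : ∀ R : ℝ, ‖weilPrimeTerm (weilConv (P.TROdd R) (weilReflect (P.TROdd R)))‖ ≤ primeBound)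
    {t₀ : ℝ} (ht₀ : 0 < t₀) (ht₁ : t₀ ≤ 1) {R : ℝ} (hR : 0 ≤ R) {Abar B' : ℝ}
    (hA : ∫ x, ‖P.TROdd R x‖ ^ 2 ≤ Abar) (hB : ∫ x, ‖deriv (P.TROdd R) x‖ ^ 2 ≤ B') {e : ℝ} (he : 0 < e) :
    ∀ᶠ k : ℕ in atTop, (weilQuadratic (weilConv (P.TROdd R) (moll k))).re ≤
      primeBound + (B' / 2 * Real.exp (t₀ / 2) * t₀ ^ 2 / 2 +
        Abar * max 0 (2 * Jexplicit t₀ - Real.log (4 * π) - Real.eulerMascheroniConstant - archC₁)) + e := by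
  set f : ℝ → ℂ := P.TROdd R with hf
  have hfc : Continuous f := continuous_TROdd hP R
  have hfs : HasCompactSupport f := hasCompactSupport_TROdd hP R
  have hf1 : ContDiff ℝ 1 f := contDiff_one_TROdd hP R
  have hf0 : ∀ u, R + 1 < |u| → f u = 0 := by
    intro u hu
    refine image_eq_zero_of_notMem_tsupport fun hmem ↦ ?_
    have h := tsupport_TROdd_subset hP hR hmem
    have : |u| ≤ R + 1 := abs_le.2 ⟨by linarith [h.1], h.2⟩
    linarith
  -- the prime term converges, so eventually it is below `primeBound + e`
  have hlim := tendsto_norm_weilPrimeTerm_moll hfc hfs hf0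
  have hev : ∀ᶠ k : ℕ in atTop,
      ‖weilPrimeTerm (weilConv (weilConv f (moll k)) (weilReflect (weilConv f (moll k))))‖ < primeBound + e :=
    (tendsto_order.1 hlim).2 _ (lt_of_le_of_lt (hprimes R) (by linarith))
  filter_upwards [hev] with k hk
  set g : ℝ → ℂ := weilConv f (moll k) with hgdef
  have hgt : IsWeilTest g := isWeilTest_weilConv_moll hfc hfs k
  have hg : ∀ u, g u = weilConv (P.TR R) (moll k) u - weilConv (P.TR R) (moll k) (-u) := fun u ↦ by
    simp only [hgdef, hf]
    exact weilConv_oddPart_moll (continuous_TR hP R) k u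
  have hodd : ∀ t, g (-t) = -g t := fun t ↦ by rw [hg, hg, neg_neg]; ring
  have hD5 : (weilPolarTerm (weilConv g (weilReflect g))).re ≤ 0 := by
    rw [re_weilPolarTerm_weilConv_weilReflect_of_odd hgt hodd]
    nlinarith [norm_nonneg (weilMellin g 0)]
  have hA' : ∫ x, ‖g x‖ ^ 2 ≤ Abar := (integral_norm_sq_weilConv_moll_le hfc hfs k).trans hA
  have hB' : ∫ x, ‖deriv g x‖ ^ 2 ≤ B' := (integral_norm_sq_deriv_weilConv_moll_le hf1 hfs k).trans hB
  have hD7' := ThetaArch.re_weilArchTerm_weilConv_weilReflect_le_thetaCheck hgt hA' hB' ht₀ ht₁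
  have key : ∀ J L γ C : ℝ, 2 * J - (L + γ) - C = 2 * J - L - γ - C := fun _ _ _ _ ↦ by ring
  rw [key] at hD7'
  have hD7 : (weilArchTerm (weilConv g (weilReflect g))).re ≤ B' / 2 * Real.exp (t₀ / 2) * t₀ ^ 2 / 2 +
      Abar * max 0 (2 * Jexplicit t₀ - Real.log (4 * π) - Real.eulerMascheroniConstant - archC₁) := by
    refine hD7'.trans (le_of_eq ?_)
    unfold Jexplicit archC₁
    ring
  have hre : (weilQuadratic g).re = (weilPolarTerm (weilConv g (weilReflect g))).re -
      (weilPrimeTerm (weilConv g (weilReflect g))).re + (weilArchTerm (weilConv g (weilReflect g))).re := by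
    simp [weilQuadratic, weilFunctional]
  have hP6 : -(weilPrimeTerm (weilConv g (weilReflect g))).re ≤ ‖weilPrimeTerm (weilConv g (weilReflect g))‖ :=
    (neg_le_abs _).trans (Complex.abs_re_le_norm _)
  rw [hre]
  linarith [hk.le]

end ThetaParams

end ThetaMellin

end Summit.RiemannHypothesis.RiemannHypothesis.Theorems.WeilColumn

end
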